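import Summits.CriticalPhenomena.CardyFormulaZ2.Theorems.HalfPlaneMarkDensityLaw.Negative.CardyContent

/-!
# `HalfPlaneMarkDensityLaw` (crux stmt-CriticalPhenomena-5661): what remains beyond the half-plane
# Cardy CDF is RATIO REGULARITY of the mark events (a template for provers; negative-side support, 5/5)

Support file of the crux disprover (cdisprove seat, 2026-08-16); `sorry`-free, standard axioms.

The converse companion of `CardyContent` §3 (a template, not a claim about percolation):
`lawSeq_tendsto_of_cdf_of_ratioRegular` — IF the lattice CDF `G_n(y) = P[A_n ↔ [⌊cn⌋,⌊yn⌋]×{0}]`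
converges to `F(η(a,b,c,y))` for `y ≥ x` (half-plane Cardy for two arcs, pointwise) AND the mark events
are ratio-regular at `x` (for every `ε` there is a window `δn` to the right of `⌊xn⌋` on which
`|P[E(k)] − P[E(⌊xn⌋)]| ≤ ε·P[E(⌊xn⌋)]` eventually), THEN the crux's conclusion holds at `(a,b,c,x)`.
Proof: the window sum of `P[E(k)]` is EXACTLY `G_n(x+δ') − G_n(x)` (`measureReal_crossing_window`,
from `MarkEvents` §2), it is within `(1±ε)·M_n·P[E(⌊xn⌋)]` with `M_n/n → δ'`
(`tendsto_floor_window_div`), and `(F(η(x+δ')) − F(η(x)))/δ' → density` (`CardyContent` §1).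
So what the route must add to half-plane Cardy is precisely a GPS-type ratio-limit statement for the
boundary two-arm event (Garban–Pete–Schramm, arXiv:1008.1378, on `𝕋`); by `MarkEvents` §5 it is a
statement about moving the three marks by `O(δ)`.
-/

noncomputable section

namespace Summit.CriticalPhenomena.CardyFormulaZ2.Theorems.HalfPlaneMarkDensityLaw.Negative

open Literature.Probability.Percolation Literature.Probability.LatticeModels
open Literature.Probability.RandomPlanarGeometry
open MeasureTheory Filter Set
open scoped ENNReal NNReal Topology
open Summit.CriticalPhenomena.CardyFormulaZ2.Theses.CardyBoundaryCoulombGas (HalfPlaneMarkDensityLaw)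

/-- Cardy's function `F` (the `RandomPlanarGeometry` copy; `Percolation.cardyFunction` agrees by `rfl`). -/
local notation "𝔽" => Literature.Probability.RandomPlanarGeometry.cardyFunction


/-! ## §9 For provers: beyond the half-plane Cardy CDF, RATIO REGULARITY of the mark events suffices

The converse companion of §3 (a template, not a claim about percolation): IF the lattice CDF
`G_n(y) = P[A_n ↔ [⌊cn⌋,⌊yn⌋]×{0}]` converges to `F(η(a,b,c,y))` for `y ≥ x` (half-plane Cardy for two
arcs, pointwise) AND the mark events are ratio-regular at `x` (for every `ε` there is a window `δn` to
the right of `⌊xn⌋` on which `|P[E(k)] − P[E(⌊xn⌋)]| ≤ ε·P[E(⌊xn⌋)]` eventually), THEN the crux's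
conclusion holds at `(a,b,c,x)` (`lawSeq_tendsto_of_cdf_of_ratioRegular`).  Proof: the window sum of
`P[E(k)]` is EXACTLY `G_n(x+δ') − G_n(x)` (§2), it is within `(1±ε)·M_n·P[E(⌊xn⌋)]` with
`M_n/n → δ'`, and `(F(η(x+δ')) − F(η(x)))/δ' → density` (§1).  So what the route must add to
half-plane Cardy is precisely a GPS-type ratio-limit statement for the boundary two-arm event; by §5 it
is a statement about moving the marks by `O(δ)`. -/

/-- Real telescoping over a window: `G(k₁+m) = G(k₁) + Σ_{i<m} P[E(k₁+1+i)]` for `k₀ ≤ k₁ + 1`. [folklore] -/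
theorem measureReal_crossing_window (S A : Set (Site 2)) {k₀ k₁ : ℤ} (hk : k₀ ≤ k₁ + 1) (m : ℕ) :
    μ.real (openCrossing S A (rowIcc k₀ (k₁ + m))) =
      μ.real (openCrossing S A (rowIcc k₀ k₁)) +
        ∑ i ∈ Finset.range m, μ.real (firstHit S A k₀ (k₁ + 1 + i)) := by
  induction m with
  | zero => simp
  | succ m ih =>
    rw [Finset.sum_range_succ, ← add_assoc, ← ih,
      measureReal_firstHit_eq_sub S A (k := k₁ + 1 + m) (by omega)]
    push_cast
    ring_nf

/-- `(⌊(x+δ)n⌋ − ⌊xn⌋)/n → δ`. [folklore] -/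
lemma tendsto_floor_window_div {x δ : ℝ} (hδ : 0 ≤ δ) :
    Tendsto (fun n : ℕ ↦ ((⌊(x + δ) * n⌋ - ⌊x * n⌋ : ℤ) : ℝ) / n) atTop (𝓝 δ) := by
  have hlow : ∀ᶠ n : ℕ in atTop, δ - 1 / (n : ℝ) ≤ ((⌊(x + δ) * n⌋ - ⌊x * n⌋ : ℤ) : ℝ) / n := by
    filter_upwards [eventually_gt_atTop 0] with n hn
    have hn' : (0 : ℝ) < n := by exact_mod_cast hn
    rw [le_div_iff₀ hn', show (δ - 1 / (n : ℝ)) * n = δ * n - 1 by field_simp]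
    have h1 := Int.lt_floor_add_one ((x + δ) * n)
    have h2 := Int.floor_le (x * n)
    push_cast
    nlinarith
  have hup : ∀ᶠ n : ℕ in atTop, ((⌊(x + δ) * n⌋ - ⌊x * n⌋ : ℤ) : ℝ) / n ≤ δ + 1 / (n : ℝ) := by
    filter_upwards [eventually_gt_atTop 0] with n hn
    have hn' : (0 : ℝ) < n := by exact_mod_cast hn
    rw [div_le_iff₀ hn', show (δ + 1 / (n : ℝ)) * n = δ * n + 1 by field_simp]
    have h1 := Int.floor_le ((x + δ) * n)
    have h2 := Int.lt_floor_add_one (x * n)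
    push_cast
    nlinarith
  have h0 : Tendsto (fun n : ℕ ↦ 1 / (n : ℝ)) atTop (𝓝 0) := tendsto_one_div_atTop_nhds_zero_nat
  refine tendsto_of_tendsto_of_tendsto_of_le_of_le' ?_ ?_ hlow hup
  · simpa using tendsto_const_nhds.sub h0
  · simpa using tendsto_const_nhds.add h0

/-- **§9 main (template)**: half-plane Cardy CDF for `y ≥ x` + ratio regularity of the mark events at
`x` ⇒ the crux's conclusion at `(a,b,c,x)`. [folklore] -/
theorem lawSeq_tendsto_of_cdf_of_ratioRegular {a b c x : ℝ} (hab : a < b) (hbc : b < c) (hcx : c < x)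
    (hcdf : ∀ y : ℝ, x ≤ y → Tendsto
      (fun n : ℕ ↦ μ.real (openCrossing halfPlane (arcA a b n) (rowIcc ⌊c * n⌋ ⌊y * n⌋))) atTop
      (𝓝 (𝔽 (crossRatio ![a, b, c, y]))))
    (hratio : ∀ ε : ℝ, 0 < ε → ∃ δ : ℝ, 0 < δ ∧ ∀ᶠ n : ℕ in atTop, ∀ k : ℤ, ⌊x * n⌋ ≤ k →
      k ≤ ⌊(x + δ) * n⌋ → |μ.real (firstHit halfPlane (arcA a b n) ⌊c * n⌋ k) -
        μ.real (markEvent a b c x n)| ≤ ε * μ.real (markEvent a b c x n)) :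
    Tendsto (lawSeq a b c x) atTop (𝓝 (density a b c x)) := by
  set d := density a b c x with hd
  have hdpos : 0 < d := density_pos hab hbc hcx
  set g : ℝ → ℝ := fun y ↦ 𝔽 (crossRatio ![a, b, c, y]) with hg
  have hderiv : HasDerivAt g d x := hasDerivAt_cardy_crossRatio hab hbc hcx
  have hslope : Tendsto (fun t : ℝ ↦ t⁻¹ * (g (x + t) - g x)) (𝓝[>] 0) (𝓝 d) := by
    simpa only [smul_eq_mul] using hderiv.tendsto_slope_zero_right
  rw [Metric.tendsto_atTop]
  intro τ hτ
  -- choice of ε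
  set ε : ℝ := min (1 / 2) (τ / (6 * (d + τ) + 6)) with hε
  have hε0 : 0 < ε := by rw [hε]; positivity
  have hε1 : ε ≤ 1 / 2 := min_le_left _ _
  have hε2 : ε ≤ τ / (6 * (d + τ) + 6) := min_le_right _ _
  have hε3 : ε * (6 * (d + τ) + 6) ≤ τ := by rwa [le_div_iff₀ (by positivity)] at hε2
  have hεd : ε * (d + τ) ≤ τ / 6 := by nlinarith [hε3, hε0.le, hdpos.le, hτ.le]
  obtain ⟨δ, hδ, hwin⟩ := hratio ε hε0
  -- choice of δ' ∈ (0, δ] with slope within τ/3 of d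
  have hsl : ∀ᶠ t : ℝ in 𝓝[>] 0, |t⁻¹ * (g (x + t) - g x) - d| < τ / 3 := by
    have := (Metric.tendsto_nhds.1 hslope) (τ / 3) (by positivity)
    simpa only [Real.dist_eq] using this
  have hI : ∀ᶠ t : ℝ in 𝓝[>] 0, t ∈ Ioc (0 : ℝ) δ := Ioc_mem_nhdsGT hδ
  obtain ⟨δ', ⟨hδ'0, hδ'δ⟩, hδ'sl⟩ := (hI.and hsl).exists
  have hδ'0le : 0 ≤ δ' := hδ'0.le
  rw [abs_sub_lt_iff] at hδ'sl
  have hq1 : δ'⁻¹ * (g (x + δ') - g x) < d + τ / 3 := by linarith [hδ'sl.1]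
  have hq2 : d - τ / 3 < δ'⁻¹ * (g (x + δ') - g x) := by linarith [hδ'sl.2]
  have hΔ : g (x + δ') - g x = δ' * (δ'⁻¹ * (g (x + δ') - g x)) := by field_simp
  have hΔup : g (x + δ') - g x < δ' * (d + τ / 3) := by
    rw [hΔ]; exact mul_lt_mul_of_pos_left hq1 hδ'0
  have hΔdn : δ' * (d - τ / 3) < g (x + δ') - g x := by
    rw [hΔ]; exact mul_lt_mul_of_pos_left hq2 hδ'0
  have hs1 : d + τ / 3 ≤ (d + τ) * (1 - ε) := by nlinarith [hεd, hε0.le, hτ.le, hdpos.le]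
  have hs2 : (d - τ) * (1 + ε) ≤ d - τ / 3 := by nlinarith [hεd, hε0.le, hτ.le, hdpos.le]
  have hval_up : (g (x + δ') - g x) / ((1 - ε) * δ') < d + τ := by
    rw [div_lt_iff₀ (mul_pos (by linarith) hδ'0)]
    calc g (x + δ') - g x < δ' * (d + τ / 3) := hΔup
      _ ≤ δ' * ((d + τ) * (1 - ε)) := mul_le_mul_of_nonneg_left hs1 hδ'0le
      _ = (d + τ) * ((1 - ε) * δ') := by ring
  have hval_dn : d - τ < (g (x + δ') - g x) / ((1 + ε) * δ') := by
    rw [lt_div_iff₀ (mul_pos (by linarith) hδ'0)]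
    calc (d - τ) * ((1 + ε) * δ') = δ' * ((d - τ) * (1 + ε)) := by ring
      _ ≤ δ' * (d - τ / 3) := mul_le_mul_of_nonneg_left hs2 hδ'0le
      _ < g (x + δ') - g x := hΔdn
  -- the window data
  set M : ℕ → ℕ := fun n ↦ (⌊(x + δ') * n⌋ - ⌊x * n⌋).toNat with hM
  have hMint : ∀ n : ℕ, ((M n : ℕ) : ℤ) = ⌊(x + δ') * n⌋ - ⌊x * n⌋ := by
    intro n; rw [hM, Int.toNat_of_nonneg]
    exact sub_nonneg.2 (Int.floor_le_floor (by nlinarith [Nat.cast_nonneg (α := ℝ) n]))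
  have hMlim : Tendsto (fun n : ℕ ↦ (M n : ℝ) / n) atTop (𝓝 δ') := by
    refine (tendsto_floor_window_div (x := x) hδ'0le).congr fun n ↦ ?_
    rw [← hMint n, Int.cast_natCast]
  set Sm : ℕ → ℝ := fun n ↦ ∑ i ∈ Finset.range (M n),
    μ.real (firstHit halfPlane (arcA a b n) ⌊c * n⌋ (⌊x * n⌋ + 1 + i)) with hSm
  have hSG : ∀ n : ℕ, Sm n = μ.real (openCrossing halfPlane (arcA a b n) (rowIcc ⌊c * n⌋ ⌊(x + δ') * n⌋)) -
      μ.real (openCrossing halfPlane (arcA a b n) (rowIcc ⌊c * n⌋ ⌊x * n⌋)) := by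
    intro n
    have hk : ⌊c * (n : ℝ)⌋ ≤ ⌊x * (n : ℝ)⌋ + 1 := by
      have := Int.floor_le_floor (mul_le_mul_of_nonneg_right hcx.le (Nat.cast_nonneg n)); omega
    have h := measureReal_crossing_window halfPlane (arcA a b n) hk (M n)
    rw [hMint, show ⌊x * (n : ℝ)⌋ + (⌊(x + δ') * n⌋ - ⌊x * n⌋) = ⌊(x + δ') * n⌋ by ring] at h
    simp only [hSm]
    linarith
  have hSlim : Tendsto Sm atTop (𝓝 (g (x + δ') - g x)) := by
    refine ((hcdf (x + δ') (by linarith)).sub (hcdf x le_rfl)).congr fun n ↦ ?_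
    rw [hSG n]
  have hq_up : Tendsto (fun n : ℕ ↦ Sm n / ((1 - ε) * ((M n : ℝ) / n))) atTop
      (𝓝 ((g (x + δ') - g x) / ((1 - ε) * δ'))) :=
    hSlim.div (tendsto_const_nhds.mul hMlim) (mul_ne_zero (by linarith) hδ'0.ne')
  have hq_dn : Tendsto (fun n : ℕ ↦ Sm n / ((1 + ε) * ((M n : ℝ) / n))) atTop
      (𝓝 ((g (x + δ') - g x) / ((1 + ε) * δ'))) :=
    hSlim.div (tendsto_const_nhds.mul hMlim) (mul_ne_zero (by linarith) hδ'0.ne')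
  have hMpos : ∀ᶠ n : ℕ in atTop, δ' / 2 < (M n : ℝ) / n :=
    hMlim.eventually (lt_mem_nhds (by linarith))
  have h_up := hq_up.eventually (gt_mem_nhds hval_up)
  have h_dn := hq_dn.eventually (lt_mem_nhds hval_dn)
  obtain ⟨N, hN⟩ := eventually_atTop.1
    ((((h_up.and h_dn).and hMpos).and hwin).and (eventually_gt_atTop 0))
  refine ⟨N, fun n hn ↦ ?_⟩
  obtain ⟨⟨⟨⟨hup, hdn⟩, hMp⟩, hw⟩, hn0⟩ := hN n hn
  have hn' : (0 : ℝ) < n := by exact_mod_cast hn0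
  set p := μ.real (markEvent a b c x n) with hp
  have hp0 : 0 ≤ p := measureReal_nonneg
  have hm0 : 0 < (M n : ℝ) := by
    have h := mul_pos (by linarith : (0 : ℝ) < (M n : ℝ) / n) hn'
    rwa [div_mul_cancel₀ _ hn'.ne'] at h
  -- term bounds from ratio regularity
  have hterm : ∀ i ∈ Finset.range (M n),
      (1 - ε) * p ≤ μ.real (firstHit halfPlane (arcA a b n) ⌊c * n⌋ (⌊x * n⌋ + 1 + i)) ∧
        μ.real (firstHit halfPlane (arcA a b n) ⌊c * n⌋ (⌊x * n⌋ + 1 + i)) ≤ (1 + ε) * p := by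
    intro i hi
    rw [Finset.mem_range] at hi
    have hk2 : ⌊x * (n : ℝ)⌋ + 1 + i ≤ ⌊(x + δ) * n⌋ := by
      have h1 : ((i : ℕ) : ℤ) + 1 ≤ ((M n : ℕ) : ℤ) := by exact_mod_cast hi
      have h2 : ⌊(x + δ') * (n : ℝ)⌋ ≤ ⌊(x + δ) * n⌋ := Int.floor_le_floor (by nlinarith [hn'.le])
      rw [hMint] at h1
      omega
    have h := hw (⌊x * n⌋ + 1 + i) (by omega) hk2
    rw [abs_le] at h
    constructor <;> linarith [h.1, h.2]
  have hsum_lo : (M n : ℝ) * ((1 - ε) * p) ≤ Sm n := by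
    have h := Finset.sum_le_sum fun i hi ↦ (hterm i hi).1
    simpa only [Finset.sum_const, Finset.card_range, nsmul_eq_mul, hSm] using h
  have hsum_hi : Sm n ≤ (M n : ℝ) * ((1 + ε) * p) := by
    have h := Finset.sum_le_sum fun i hi ↦ (hterm i hi).2
    simpa only [Finset.sum_const, Finset.card_range, nsmul_eq_mul, hSm] using h
  -- conclude
  rw [Real.dist_eq, abs_sub_lt_iff]
  have hlaw : lawSeq a b c x n = (n : ℝ) * p := rfl
  have hpos1 : 0 < (1 - ε) * ((M n : ℝ) / n) := mul_pos (by linarith) (div_pos hm0 hn')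
  have hpos2 : 0 < (1 + ε) * ((M n : ℝ) / n) := mul_pos (by linarith) (div_pos hm0 hn')
  constructor
  · have h1 : (n : ℝ) * p ≤ Sm n / ((1 - ε) * ((M n : ℝ) / n)) := by
      rw [le_div_iff₀ hpos1]
      calc (n : ℝ) * p * ((1 - ε) * ((M n : ℝ) / n)) = (M n : ℝ) * ((1 - ε) * p) := by
            field_simp
        _ ≤ Sm n := hsum_lo
    rw [hlaw]; linarith [hup]
  · have h1 : Sm n / ((1 + ε) * ((M n : ℝ) / n)) ≤ (n : ℝ) * p := by
      rw [div_le_iff₀ hpos2]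
      calc Sm n ≤ (M n : ℝ) * ((1 + ε) * p) := hsum_hi
        _ = (n : ℝ) * p * ((1 + ε) * ((M n : ℝ) / n)) := by field_simp
    rw [hlaw]; linarith [hdn]

end Summit.CriticalPhenomena.CardyFormulaZ2.Theorems.HalfPlaneMarkDensityLaw.Negative
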